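/-
Copyright (c) 2026 the pub-hodgecm-mathlib formalisation cell (harness21).  Prover seat hodgecm-mathlib-F0P3a-p01 (g18): road «S3-ram», (Cnt2′) ROUTE B, chair F0P3a-p07 (g15)
RULING (16)(c) ∕ (17) — THE HYPERBOLIC ROOT CENSUS AT ODD ROOT DEPTH (regimes A-odd ∕ C), lattice model `Φ₃ = J₀`, 2026-09-02.
-/
import Literature.NumberTheory.Rogawski1990.DepthZeroKappaTransferTypeTwoRamifiedHyperbolicRootSlices     -- ★ p849311 ∕ ED. 2 ★ p849330 (this seat): `rootRegionPackage_hyperbolic_of_lineCounts`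
import Literature.NumberTheory.Rogawski1990.DepthZeroKappaTransferTypeTwoRamifiedHyperbolicRootResidual   -- p849462 (this seat): residual data of `B₀`, `natCard_conicNull_of_iotaShape`, trichotomy; brings ★ p849383 (junction)
import Literature.NumberTheory.Automorphic.UnitaryLatticeTreeFrameLiteralCentring                          -- ★ (A-p19 (g29) FILE 1): `charpoly_coe_endoGL_one`, `map_sub_one_stdLattice_le_scaleLattice_endoGL_one`
import Literature.NumberTheory.Automorphic.UnitaryLatticeTreeNilpotencyTokenOfDepths                       -- ★ `map_sub_one_pow_three_le_scaleLattice_of_charpoly_block_antidiagonal` (`hnil3`)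
import HarnessLib

/-!
# The hyperbolic root census at odd root depth (regimes A-odd ∕ C): `R = {L₀}`, `(NE, NP + NM) ∈ {(2q, (q−1)q), (0, (q+1)q)}` keyed on `χ(det Ȳ_W)`

For the centred hyperbolic literal `γ = ι(B₀, 1) ∈ U(σ, J₀) ∩ K₀` at ODD root depth `d₀ ≥ 3` — `B₀ ∈ U(σ, !![0,1;1,0])`, `|B₀ − 1| ≤ |ϖ|^{d₀}`, `χ_{B₀}` rootless,
`|disc B₀| = |ϖ|^{2d₀}`, leading matrix `Y = (ϖ^{d₀})⁻¹(B₀ − 1)`, W-root-set `= {𝒪²}` — `rootRegionCensus_hyperbolic_odd` delivers the `(sR, hsR)` input of ★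
`BlockLawHyp.hyperbolicTotal_zero_ram_of_region_census_odd` (F0P3a-p08 (g20), p849287) with `sR = {L₀}` together with atoms `(NE, NP, NM) = q·(νE, νP, νM)` for its
`hNE hNP hNM` sums, AND the finite law of the atoms: `νE + νP + νM = q + 1`, `νE = 2` if `χ(det Ȳ) = 1`, `νE = 0` if `χ(det Ȳ) = −1` (so `NP + NM = (q ∓ 1)q`).
Chain: ★ `rootRegionPackage_hyperbolic_of_lineCounts` (p849330; its `hnil3` by ★ `map_sub_one_pow_three_le_scaleLattice_of_charpoly_block_antidiagonal`, its `hχ` by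
`v_det_sub_smul_one_eq_of_leading`, its `hroot` by ★ `map_sub_one_stdLattice_le_scaleLattice_endoGL_one`, its `νX` := the child-set sizes themselves) ∘ ★ p849383
(`ncard_rootChildren_{null,negClass,negClass_mul}_eq_natCard`: child sets ↦ conic fibres) ∘ p849462 (`residue_leading_diag_eq`, `quadraticChar_residue_leading_offDiag_eq_neg_one`,
`natCard_conicNull_of_iotaShape`, `natCard_conic_null_add_quadraticChar_eq`).  Both regime A-odd (`Ȳ_W` traceless) and the tie regime C (`Ȳ_W = !![β, y; x, β]`, `β ≠ 0`)
are covered: only `χ(xy) = −1` (residual irreducibility) is used.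

References: [cite: Rogawski1990, §4.9 Prop. 4.9.1 (b) p. 55, Lemma 4.9.3 p. 56]; [cite: Kottwitz1986, §3]; [cite: BruhatTits1972, §10]; [cite: IrelandRosen1990, Ch. 8 §1].
-/

set_option autoImplicit false

noncomputable section

open scoped Valued WithZero Matrix MatrixGroups
open Polynomial Classical SimpleGraph
open Literature.NumberTheory.Automorphic Literature.NumberTheory.Automorphic.HermitianLattice Literature.NumberTheory.Automorphic.UnitaryLatticeTree

namespace Literature.NumberTheory.Rogawski1990.TypeOneRamifiedJunction

variable {K : Type*} [Field K] [Valued K ℤᵐ⁰] {σ : K →+* K} {ϖ : K}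

set_option maxHeartbeats 1600000 in -- budget only: statement-heavy lattice tokens (★ p849330's conclusion verbatim).
/-- **THE HYPERBOLIC ROOT CENSUS AT ODD ROOT DEPTH** (regimes A-odd ∕ C; see the module docstring): ★ p849330's root-region package at `sR = {L₀}` with the atoms
`νE, νP, νM` EXHIBITED and their finite law `νE + νP + νM = q + 1`, `νE = 2 ∕ 0` according as `χ(det Ȳ_W) = ±1`. [cite: Rogawski1990, §4.9 Prop. 4.9.1 (b) p. 55, Lemma 4.9.3 p. 56]
[cite: Kottwitz1986, §3] [cite: BruhatTits1972, §10] [cite: IrelandRosen1990, Ch. 8 §1] -/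
theorem rootRegionCensus_hyperbolic_odd [IsPrincipalIdealRing 𝒪[K]] (hσ : ∀ x, σ (σ x) = x) (hvσ : ∀ a, Valued.v (σ a) = Valued.v a) (hσϖ : σ ϖ = -ϖ)
    (hϖ : Valued.v ϖ = WithZero.exp (-1 : ℤ)) (hres : ∀ x : K, Valued.v x ≤ 1 → Valued.v (σ x - x) < 1) (h2 : Valued.v (2 : K) = 1) [Fintype 𝓀[K]] [DecidableEq 𝓀[K]]
    (hT : (latticeGraph σ ϖ ((StdForm.antidiagonal 3).over K)).IsTree)
    {γ : unitaryGroupOfForm σ ((StdForm.antidiagonal 3).over K)} (hγ0 : γ ∈ unitaryInt σ ((StdForm.antidiagonal 3).over K))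
    (B₀ : GL (Fin 2) K) (hγ : (γ : GL (Fin 3) K) = endoGL (B₀, (1 : GL (Fin 1) K)))
    {d₀ : ℕ} (hd3 : 3 ≤ d₀) (hodd : Odd d₀)
    (hsq : ∀ t : K, Valued.v (t - 1) < 1 → IsSquare t)
    (hU : B₀ ∈ unitaryGroupOfForm σ (!![(0 : K), 1; 1, 0] : Matrix (Fin 2) (Fin 2) K))
    (hirr : ¬ ∃ x : K, ((B₀ : Matrix (Fin 2) (Fin 2) K).charpoly).IsRoot x)
    (hdisc : Valued.v ((B₀ : Matrix (Fin 2) (Fin 2) K).trace ^ 2 - 4 * (B₀ : Matrix (Fin 2) (Fin 2) K).det) = Valued.v ϖ ^ (2 * d₀))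
    (Y : Matrix (Fin 2) (Fin 2) 𝒪[K]) (hY : ∀ i j, ((Y i j : 𝒪[K]) : K) = (ϖ ^ d₀)⁻¹ * (((B₀ : Matrix (Fin 2) (Fin 2) K) - 1) i j))
    (hBm : ∀ i j, Valued.v (((B₀ : Matrix (Fin 2) (Fin 2) K) - 1) i j) ≤ Valued.v ϖ ^ d₀)
    (hWtop : {B : Submodule 𝒪[K] (Fin 2 → K) | IsSelfDualLattice σ ϖ (!![(0 : K), 1; 1, 0] : Matrix (Fin 2) (Fin 2) K) B ∧ mapGL B₀ B = B ∧
        B.map ((Matrix.toLin' ((B₀ : Matrix (Fin 2) (Fin 2) K) - 1)).restrictScalars 𝒪[K]) ≤ scaleLattice (ϖ ^ d₀) B} = {stdLattice K 2})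
    (c₁ ε : K) (hc₁ : Valued.v c₁ = 1) (hεv : Valued.v ε = 1) (hε : ∀ z : K, Valued.v z ≤ 1 → Valued.v (z ^ 2 - ε) = 1) :
    (∀ v, v ∈ ({⟨stdLattice K 3, 0, isSelfDualLattice_stdLattice_three_of_v hϖ⟩} : Finset {M : Submodule 𝒪[K] (Fin 3 → K) // IsVertex σ ϖ ((StdForm.antidiagonal 3).over K) M}) ↔ v ∈ {v : {M : Submodule 𝒪[K] (Fin 3 → K) // IsVertex σ ϖ ((StdForm.antidiagonal 3).over K) M} | latticeGraphIso σ ϖ ((StdForm.antidiagonal 3).over K) γ v = v ∧ IsSelfDualLattice σ ϖ ((StdForm.antidiagonal 3).over K) v.1 ∧ v.1.map ((Matrix.toLin' (((γ : GL (Fin 3) K) : Matrix (Fin 3) (Fin 3) K) - 1)).restrictScalars 𝒪[K]) ≤ scaleLattice (ϖ ^ d₀) v.1}) ∧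
    ∃ νE νP νM : ℕ,
    (∑ v ∈ ({⟨stdLattice K 3, 0, isSelfDualLattice_stdLattice_three_of_v hϖ⟩} : Finset {M : Submodule 𝒪[K] (Fin 3 → K) // IsVertex σ ϖ ((StdForm.antidiagonal 3).over K) M}), ({w | w ∈ {w | ∃ c, ((latticeGraph σ ϖ ((StdForm.antidiagonal 3).over K)).Adj v c ∧ (latticeGraph σ ϖ ((StdForm.antidiagonal 3).over K)).dist ⟨stdLattice K 3, 0, isSelfDualLattice_stdLattice_three_of_v hϖ⟩ c = (latticeGraph σ ϖ ((StdForm.antidiagonal 3).over K)).dist ⟨stdLattice K 3, 0, isSelfDualLattice_stdLattice_three_of_v hϖ⟩ v + 1 ∧ latticeGraphIso σ ϖ ((StdForm.antidiagonal 3).over K) γ c = c) ∧ ((latticeGraph σ ϖ ((StdForm.antidiagonal 3).over K)).Adj c w ∧ (latticeGraph σ ϖ ((StdForm.antidiagonal 3).over K)).dist ⟨stdLattice K 3, 0, isSelfDualLattice_stdLattice_three_of_v hϖ⟩ w = (latticeGraph σ ϖ ((StdForm.antidiagonal 3).over K)).dist ⟨stdLattice K 3, 0, isSelfDualLattice_stdLattice_three_of_v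 hϖ⟩ c + 1 ∧ latticeGraphIso σ ϖ ((StdForm.antidiagonal 3).over K) γ w = w)} ∧ (¬ w.1.map ((Matrix.toLin' (((γ : GL (Fin 3) K) : Matrix (Fin 3) (Fin 3) K) - 1)).restrictScalars 𝒪[K]) ≤ scaleLattice (ϖ ^ d₀) w.1 ∧ (w.1.map ((Matrix.toLin' (((γ : GL (Fin 3) K) : Matrix (Fin 3) (Fin 3) K) - 1)).restrictScalars 𝒪[K]) ≤ scaleLattice (ϖ ^ (d₀ - 1)) w.1 ∧ ¬ w.1.map ((Matrix.toLin' (((γ : GL (Fin 3) K) : Matrix (Fin 3) (Fin 3) K) - 1)).restrictScalars 𝒪[K]) ≤ scaleLattice (ϖ ^ d₀) w.1))}).ncard = Nat.card 𝓀[K] * νE) ∧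
    (∑ v ∈ ({⟨stdLattice K 3, 0, isSelfDualLattice_stdLattice_three_of_v hϖ⟩} : Finset {M : Submodule 𝒪[K] (Fin 3 → K) // IsVertex σ ϖ ((StdForm.antidiagonal 3).over K) M}), ({w | w ∈ {w | ∃ c, ((latticeGraph σ ϖ ((StdForm.antidiagonal 3).over K)).Adj v c ∧ (latticeGraph σ ϖ ((StdForm.antidiagonal 3).over K)).dist ⟨stdLattice K 3, 0, isSelfDualLattice_stdLattice_three_of_v hϖ⟩ c = (latticeGraph σ ϖ ((StdForm.antidiagonal 3).over K)).dist ⟨stdLattice K 3, 0, isSelfDualLattice_stdLattice_three_of_v hϖ⟩ v + 1 ∧ latticeGraphIso σ ϖ ((StdForm.antidiagonal 3).over K) γ c = c) ∧ ((latticeGraph σ ϖ ((StdForm.antidiagonal 3).over K)).Adj c w ∧ (latticeGraph σ ϖ ((StdForm.antidiagonal 3).over K)).dist ⟨stdLattice K 3, 0, isSelfDualLattice_stdLattice_three_of_v hϖ⟩ w = (latticeGraph σ ϖ ((StdForm.antidiagonal 3).over K)).dist ⟨stdLattice K 3, 0, isSelfDualLattice_stdLattice_three_of_v hϖ⟩ c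 + 1 ∧ latticeGraphIso σ ϖ ((StdForm.antidiagonal 3).over K) γ w = w)} ∧ (¬ w.1.map ((Matrix.toLin' (((γ : GL (Fin 3) K) : Matrix (Fin 3) (Fin 3) K) - 1)).restrictScalars 𝒪[K]) ≤ scaleLattice (ϖ ^ d₀) w.1 ∧ (w.1.map ((Matrix.toLin' (((γ : GL (Fin 3) K) : Matrix (Fin 3) (Fin 3) K) - 1)).restrictScalars 𝒪[K]) ≤ scaleLattice (ϖ ^ (d₀ - 2)) w.1 ∧ ¬ w.1.map ((Matrix.toLin' (((γ : GL (Fin 3) K) : Matrix (Fin 3) (Fin 3) K) - 1)).restrictScalars 𝒪[K]) ≤ scaleLattice (ϖ ^ (d₀ - 1)) w.1) ∧ ∃ y ∈ w.1, ∃ a : K, Valued.v a = 1 ∧ Valued.v ((ϖ ^ (d₀ - 2))⁻¹ * pairing σ ((StdForm.antidiagonal 3).over K) y ((((γ : GL (Fin 3) K) : Matrix (Fin 3) (Fin 3) K) - 1) *ᵥ y) - (c₁) * a ^ 2) < 1)}).ncard = Nat.card 𝓀[K] * νP) ∧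
    (∑ v ∈ ({⟨stdLattice K 3, 0, isSelfDualLattice_stdLattice_three_of_v hϖ⟩} : Finset {M : Submodule 𝒪[K] (Fin 3 → K) // IsVertex σ ϖ ((StdForm.antidiagonal 3).over K) M}), ({w | w ∈ {w | ∃ c, ((latticeGraph σ ϖ ((StdForm.antidiagonal 3).over K)).Adj v c ∧ (latticeGraph σ ϖ ((StdForm.antidiagonal 3).over K)).dist ⟨stdLattice K 3, 0, isSelfDualLattice_stdLattice_three_of_v hϖ⟩ c = (latticeGraph σ ϖ ((StdForm.antidiagonal 3).over K)).dist ⟨stdLattice K 3, 0, isSelfDualLattice_stdLattice_three_of_v hϖ⟩ v + 1 ∧ latticeGraphIso σ ϖ ((StdForm.antidiagonal 3).over K) γ c = c) ∧ ((latticeGraph σ ϖ ((StdForm.antidiagonal 3).over K)).Adj c w ∧ (latticeGraph σ ϖ ((StdForm.antidiagonal 3).over K)).dist ⟨stdLattice K 3, 0, isSelfDualLattice_stdLattice_three_of_v hϖ⟩ w = (latticeGraph σ ϖ ((StdForm.antidiagonal 3).over K)).dist ⟨stdLattice K 3, 0, isSelfDualLattice_stdLattice_three_of_v hϖ⟩ c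 + 1 ∧ latticeGraphIso σ ϖ ((StdForm.antidiagonal 3).over K) γ w = w)} ∧ (¬ w.1.map ((Matrix.toLin' (((γ : GL (Fin 3) K) : Matrix (Fin 3) (Fin 3) K) - 1)).restrictScalars 𝒪[K]) ≤ scaleLattice (ϖ ^ d₀) w.1 ∧ (w.1.map ((Matrix.toLin' (((γ : GL (Fin 3) K) : Matrix (Fin 3) (Fin 3) K) - 1)).restrictScalars 𝒪[K]) ≤ scaleLattice (ϖ ^ (d₀ - 2)) w.1 ∧ ¬ w.1.map ((Matrix.toLin' (((γ : GL (Fin 3) K) : Matrix (Fin 3) (Fin 3) K) - 1)).restrictScalars 𝒪[K]) ≤ scaleLattice (ϖ ^ (d₀ - 1)) w.1) ∧ ¬ (∃ y ∈ w.1, ∃ a : K, Valued.v a = 1 ∧ Valued.v ((ϖ ^ (d₀ - 2))⁻¹ * pairing σ ((StdForm.antidiagonal 3).over K) y ((((γ : GL (Fin 3) K) : Matrix (Fin 3) (Fin 3) K) - 1) *ᵥ y) - (c₁) * a ^ 2) < 1))}).ncard = Nat.card 𝓀[K] * νM) ∧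
      νE + νP + νM = Nat.card 𝓀[K] + 1 ∧
      (quadraticChar 𝓀[K] (IsLocalRing.residue 𝒪[K] (Y 0 0 * Y 1 1 - Y 0 1 * Y 1 0)) = 1 → νE = 2) ∧
      (quadraticChar 𝓀[K] (IsLocalRing.residue 𝒪[K] (Y 0 0 * Y 1 1 - Y 0 1 * Y 1 0)) = -1 → νE = 0) := by
  have hϖ0 : ϖ ≠ 0 := fun h0 => by rw [h0, map_zero] at hϖ; exact WithZero.coe_ne_zero hϖ.symm
  have hϖlt : Valued.v ϖ < 1 := by rw [hϖ, ← WithZero.exp_zero]; exact WithZero.exp_lt_exp.2 (by norm_num)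
  have hvϖ0 : 0 < Valued.v ϖ := by rw [hϖ]; exact WithZero.exp_pos
  have hk2 : ringChar 𝓀[K] ≠ 2 := ringChar_residueField_ne_two h2
  have h2k : (2 : 𝓀[K]) ≠ 0 := Ring.two_ne_zero hk2
  -- the residual data of `B₀`
  have hdiag := v_leading_diag_sub_lt_one hvσ hσϖ hϖ hres hU hodd Y hY
  have hdiagr := residue_leading_diag_eq hvσ hσϖ hϖ hres hU hodd Y hY
  have h4 := forall_v_sq_sub_four_mul_eq_one h2 hsq hϖ hirr hdisc Y hY hdiag
  have hirrr := quadraticChar_residue_leading_offDiag_eq_neg_one h2 hsq hϖ hirr hdisc Y hY hdiag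
  -- ★ p849330's inputs `hnil3`, `hχ`, `hroot`
  have hchar : (((γ : GL (Fin 3) K) : Matrix (Fin 3) (Fin 3) K)).charpoly = (X - C 1) * (B₀ : Matrix (Fin 2) (Fin 2) K).charpoly := by
    rw [hγ]; exact charpoly_coe_endoGL_one B₀
  have hnil3 : ∀ (w : {M : Submodule 𝒪[K] (Fin 3 → K) // IsVertex σ ϖ ((StdForm.antidiagonal 3).over K) M}) (e : ℕ), e + 1 ≤ d₀ →
         w.1.map ((Matrix.toLin' (((γ : GL (Fin 3) K) : Matrix (Fin 3) (Fin 3) K) - 1)).restrictScalars 𝒪[K]) ≤ scaleLattice (ϖ ^ e) w.1 →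
         w.1.map ((Matrix.toLin' ((((γ : GL (Fin 3) K) : Matrix (Fin 3) (Fin 3) K) - 1) ^ 3)).restrictScalars 𝒪[K]) ≤ scaleLattice (ϖ ^ (3 * e + 1)) w.1 := by
    intro w e he hlev
    refine map_sub_one_pow_three_le_scaleLattice_of_charpoly_block_antidiagonal hϖ hchar (d := e) (by rw [sub_self, map_zero]; exact zero_le)
      (fun i j => (hBm i j).trans ?_) w hlev
    exact pow_le_pow_right_of_le_one' hϖlt.le he
  have hχ : ∀ t : K, Valued.v (t - 1) ≤ Valued.v (ϖ ^ d₀) →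
         Valued.v ϖ ^ (2 * d₀ + 1) < Valued.v (((B₀ : Matrix (Fin 2) (Fin 2) K) - t • (1 : Matrix (Fin 2) (Fin 2) K)).det) := fun t ht => by
    rw [v_det_sub_smul_one_eq_of_leading h2 hϖ Y hY hdiag h4 t ht]
    exact pow_lt_pow_right_of_lt_one₀ hvϖ0 hϖlt (by omega)
  have hroot : (stdLattice K 3).map ((Matrix.toLin' (((γ : GL (Fin 3) K) : Matrix (Fin 3) (Fin 3) K) - 1)).restrictScalars 𝒪[K]) ≤ scaleLattice (ϖ ^ d₀) (stdLattice K 3) := by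
    rw [hγ]; exact map_sub_one_stdLattice_le_scaleLattice_endoGL_one hϖ0 hBm
  obtain ⟨hsR, hPE, hPP, hPM⟩ := rootRegionPackage_hyperbolic_of_lineCounts hσ hvσ hσϖ hϖ hres h2 hT hγ0 B₀ hγ hd3 hodd hnil3 hBm hχ hroot hWtop
    c₁ ε hc₁ hεv hε _ _ _ rfl rfl rfl
  refine ⟨hsR, _, _, _, hPE, hPP, hPM, ?_⟩
  -- the junction: child sets ↦ conic fibres (★ p849383), with the 3 × 3 leading matrix `Y₀ = ι(Y, 0)`
  let Y₀ : Matrix (Fin 3) (Fin 3) 𝒪[K] := !![Y 0 0, 0, Y 0 1; 0, 0, 0; Y 1 0, 0, Y 1 1]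
  have hY₀ : ∀ i j, ((Y₀ i j : 𝒪[K]) : K) = (ϖ ^ d₀)⁻¹ * ((((γ : GL (Fin 3) K) : Matrix (Fin 3) (Fin 3) K) - 1) i j) := by
    intro i j
    rw [hγ, coe_endoGL_sub_one_eq_endoShape]
    fin_cases i <;> fin_cases j <;> simp [Y₀, hY]
  have c₀O : Valued.v c₁ ≤ 1 := hc₁.le
  have ε₀O : Valued.v ε ≤ 1 := hεv.le
  have hE := ncard_rootChildren_null_eq_natCard hσ hvσ hσϖ hϖ hres h2 γ Y₀ hY₀
  have hP := ncard_rootChildren_negClass_eq_natCard hσ hvσ hσϖ hϖ hres h2 γ Y₀ hY₀ c₁ ⟨c₁, c₀O⟩ rfl hc₁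
  have hM := ncard_rootChildren_negClass_mul_eq_natCard hσ hvσ hσϖ hϖ hres h2 γ Y₀ hY₀ c₁ ε ⟨c₁, c₀O⟩ ⟨ε, ε₀O⟩ rfl rfl hc₁ hεv hε
  rw [hE, hP, hM]
  -- the finite law
  have hc0 : (IsLocalRing.residue 𝒪[K] (-⟨c₁, c₀O⟩))⁻¹ ≠ 0 := by
    refine inv_ne_zero fun h => ?_
    rw [residue_eq_zero_iff_v_lt_one] at h
    push_cast at h
    rw [Valuation.map_neg, hc₁] at h
    exact lt_irrefl _ h
  have hsum := natCard_conic_null_add_quadraticChar_eq h2k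
    (fun p : Option {p : 𝓀[K] × 𝓀[K] // p.2 + (RingHom.id 𝓀[K]) p.2 + p.1 * (RingHom.id 𝓀[K]) p.1 = 0} =>
      (p.elim (Pi.single 2 1) fun q => ![(1 : 𝓀[K]), q.1.1, q.1.2]) ⬝ᵥ
        ((((StdForm.antidiagonal 3).over 𝓀[K]) * Y₀.map (IsLocalRing.residue 𝒪[K])) *ᵥ (p.elim (Pi.single 2 1) fun q => ![(1 : 𝓀[K]), q.1.1, q.1.2]))) hc0
  have hnull := natCard_conicNull_of_iotaShape hk2 (Y₀.map (IsLocalRing.residue 𝒪[K]))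
    (by simp [Y₀]) (by simp [Y₀]) (by simp [Y₀]) (by simp [Y₀]) (by simp [Y₀])
    (by simp only [Y₀, Matrix.map_apply, Matrix.of_apply, Matrix.cons_val', Matrix.cons_val_zero, Matrix.cons_val_two, Matrix.tail_cons, Matrix.head_cons,
      Matrix.empty_val', Matrix.cons_val_fin_one]; exact hdiagr.symm)
    (by simp only [Y₀, Matrix.map_apply, Matrix.of_apply, Matrix.cons_val', Matrix.cons_val_zero, Matrix.cons_val_two, Matrix.tail_cons, Matrix.head_cons,
      Matrix.empty_val', Matrix.cons_val_fin_one]; exact hirrr)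
  have hdet : IsLocalRing.residue 𝒪[K] (Y 0 0 * Y 1 1 - Y 0 1 * Y 1 0) =
      (Y₀.map (IsLocalRing.residue 𝒪[K])) 0 0 ^ 2 - (Y₀.map (IsLocalRing.residue 𝒪[K])) 0 2 * (Y₀.map (IsLocalRing.residue 𝒪[K])) 2 0 := by
    show _ = IsLocalRing.residue 𝒪[K] (Y 0 0) ^ 2 - IsLocalRing.residue 𝒪[K] (Y 0 1) * IsLocalRing.residue 𝒪[K] (Y 1 0)
    rw [map_sub, map_mul, map_mul, ← hdiagr]
    ring
  refine ⟨hsum, fun h => hnull.1 (hdet ▸ h), fun h => hnull.2 (hdet ▸ h)⟩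

end Literature.NumberTheory.Rogawski1990.TypeOneRamifiedJunction

end
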